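import Literature.Analysis.FluidPDE.TypeIAncientMild
import Literature.Analysis.FluidPDE.HyperbolicDSSOrbit
import Literature.Analysis.FluidPDE.SereginSverak2002RadialZoomLimit
import HarnessLib

/-!
# Crux `MustSqueeze` (stmt-NavierStokesRegularity-11610), line `outward-drift-signed-flux`:
# the similarity dictionary `stub_simDictionary`

H4 (the Type-I rate `‖u(t, x)‖ ≤ C/√(-t)` inside `IsTypeIAncientMild`) and H5a (bounded scaled
local kinetic energies `r⁻¹ ∫_{B_r(x₀)} ‖u(t)‖² ≤ C` on backward parabolic cylinders
`Q_r(x₀, t₀)`, `t₀ ≤ 0`) read in backward similarity variables `U = lerayOrbit u`,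
`U(s, y) = e^{-s/2} u(-e^{-s}, e^{-s/2} y)`:

* `‖U(s, y)‖ ≤ C` for all `s, y`;
* `∫_{B_ρ(y₀)} ‖U(s, y)‖² dy ≤ C ρ` for all `s`, `y₀` and `ρ > 0`.

The second is the change of variables `y = x/λ`, `λ = e^{-s/2} = √(-t)`, `t = -e^{-s}`,
`x₀ = λ y₀`, `r = ρ λ`: `∫_{B_ρ(y₀)} ‖U(s)‖² = λ⁻¹ ∫_{B_r(x₀)} ‖u(t)‖²` (translation invariance of
Lebesgue measure and `SereginSverak2002.setIntegral_ball_norm_sq_zoom`), followed by H5a on the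
cylinder `Q_r(x₀, t₀)` with top `t₀ = min 0 (t + r²/2)`, for which `t₀ - r² < t < t₀`.
-/

noncomputable section

open MeasureTheory Set Metric

namespace Summit.NavierStokesRegularity.NavierStokesRegularity.Theorems

open Literature.Analysis.FluidPDE

/-- Physical / similarity space `ℝ³`. -/
local notation "ℝ³" => EuclideanSpace ℝ (Fin 3)

/-- Translation of set integrals over balls to balls centred at the origin:
`∫_{B(y₀, ρ)} f = ∫_{B(0, ρ)} f(y₀ + y) dy` (Lebesgue measure is translation invariant). [folklore] -/
theorem mustSqueeze_setIntegral_ball_eq_comp_add {F : Type*} [NormedAddCommGroup F]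
    [NormedSpace ℝ F] (f : ℝ³ → F) (y₀ : ℝ³) (ρ : ℝ) :
    ∫ y in ball y₀ ρ, f y = ∫ y in ball (0 : ℝ³) ρ, f (y₀ + y) := by
  have hmp : MeasurePreserving (fun y : ℝ³ => y₀ + y) volume volume :=
    measurePreserving_add_left volume y₀
  have hemb : MeasurableEmbedding (fun y : ℝ³ => y₀ + y) :=
    (MeasurableEquiv.addLeft y₀).measurableEmbedding
  have hpre : (fun y : ℝ³ => y₀ + y) ⁻¹' ball y₀ ρ = ball 0 ρ := by
    ext y
    simp [mem_ball, dist_eq_norm]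
  rw [← hpre]
  exact (hmp.setIntegral_preimage_emb hemb f (ball y₀ ρ)).symm

/-- **The Type-I rate in similarity variables**: `‖U(s, y)‖ ≤ C`
(`‖U(s, y)‖ = e^{-s/2} ‖u(-e^{-s}, ·)‖ ≤ e^{-s/2} · C/√(e^{-s}) = C`). [folklore] -/
theorem mustSqueeze_norm_lerayOrbit_le {C : ℝ} {u : ℝ → ℝ³ → ℝ³} (h : IsTypeIAncientMild C u)
    (s : ℝ) (y : ℝ³) : ‖lerayOrbit u s y‖ ≤ C := by
  have hpos : 0 < Real.exp (-s / 2) := Real.exp_pos _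
  have key := h.norm_le (t := -Real.exp (-s)) (by simpa using Real.exp_pos (-s))
    (Real.exp (-s / 2) • y)
  rw [neg_neg, sqrt_exp_neg] at key
  rw [lerayOrbit_apply, norm_smul, Real.norm_of_nonneg hpos.le]
  calc Real.exp (-s / 2) * ‖u (-Real.exp (-s)) (Real.exp (-s / 2) • y)‖
      ≤ Real.exp (-s / 2) * (C / Real.exp (-s / 2)) := by gcongr
    _ = C := by field_simp

/-- **The slice energy of the orbit on a ball is a rescaled physical local energy**:
`∫_{B_ρ(y₀)} ‖U(s)‖² = λ⁻¹ ∫_{B_{ρλ}(λ y₀)} ‖u(-e^{-s})‖²`, `λ = e^{-s/2}` (translation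
invariance and the zoom `y ↦ λ y₀ + λ y`, `SereginSverak2002.setIntegral_ball_norm_sq_zoom`). [folklore] -/
theorem mustSqueeze_setIntegral_ball_norm_sq_lerayOrbit (u : ℝ → ℝ³ → ℝ³) (s : ℝ) (y₀ : ℝ³)
    (ρ : ℝ) :
    ∫ y in ball y₀ ρ, ‖lerayOrbit u s y‖ ^ 2 =
      (Real.exp (-s / 2))⁻¹ *
        ∫ x in ball (Real.exp (-s / 2) • y₀) (ρ * Real.exp (-s / 2)),
          ‖u (-Real.exp (-s)) x‖ ^ 2 := by
  have hpos : 0 < Real.exp (-s / 2) := Real.exp_pos _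
  rw [mustSqueeze_setIntegral_ball_eq_comp_add,
    ← SereginSverak2002.setIntegral_ball_norm_sq_zoom (u (-Real.exp (-s))) _ hpos ρ]
  refine setIntegral_congr_fun measurableSet_ball (fun y _ => ?_)
  simp only [lerayOrbit_apply, smul_add]

/-- **stub_simDictionary** — H4 and H5a read in backward similarity variables: the orbit
`U = lerayOrbit u` is bounded by `C`, and its slices have linear `L²` Morrey growth
`∫_{B_ρ(y₀)} |U(s)|² ≤ Cρ` (scaling `y = x/√(−t)`, `x₀ = √(−t)y₀`, `r = √(−t)ρ`, and H5a on a
cylinder with top `t₀ = min 0 (t + r²/2)`, so that `t₀ - r² < t < t₀ ≤ 0`). -/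
theorem stub_simDictionary : ∀ (C : ℝ) (u : ℝ → ℝ³ → ℝ³), IsTypeIAncientMild C u →
    (∀ (x₀ : EuclideanSpace ℝ (Fin 3)) (t₀ r : ℝ), t₀ ≤ 0 → 0 < r →
      (∀ t, t₀ - r^2 < t → t < t₀ → r⁻¹ * ∫ x in Metric.ball x₀ r, ‖u t x‖^2 ≤ C) ∧
      r⁻¹ * ∫ t in Set.Ioo (t₀ - r^2) t₀, ∫ x in Metric.ball x₀ r, ‖fderiv ℝ (u t) x‖^2 ≤ C) →
    (∀ (s : ℝ) (y : ℝ³), ‖lerayOrbit u s y‖ ≤ C) ∧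
    (∀ (s : ℝ) (y₀ : ℝ³) (ρ : ℝ), 0 < ρ →
      ∫ y in Metric.ball y₀ ρ, ‖lerayOrbit u s y‖ ^ 2 ≤ C * ρ) := by
  intro C u hK h5
  refine ⟨fun s y => mustSqueeze_norm_lerayOrbit_le hK s y, fun s y₀ ρ hρ => ?_⟩
  rw [mustSqueeze_setIntegral_ball_norm_sq_lerayOrbit]
  set lam : ℝ := Real.exp (-s / 2) with hlam
  have hlam_pos : 0 < lam := Real.exp_pos _
  set t : ℝ := -Real.exp (-s) with ht
  have ht_neg : t < 0 := by simpa [ht] using Real.exp_pos (-s)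
  have hr_pos : 0 < ρ * lam := mul_pos hρ hlam_pos
  have hr2 : 0 < (ρ * lam) ^ 2 := pow_pos hr_pos 2
  -- H5a on the cylinder `Q_r(x₀, t₀)`, `x₀ = λ y₀`, `r = ρ λ`, `t₀ = min 0 (t + r²/2)`
  have h1 : min 0 (t + (ρ * lam) ^ 2 / 2) - (ρ * lam) ^ 2 < t := by
    have := min_le_right 0 (t + (ρ * lam) ^ 2 / 2)
    linarith
  have h2 : t < min 0 (t + (ρ * lam) ^ 2 / 2) := lt_min ht_neg (by linarith)
  have hH := (h5 (lam • y₀) (min 0 (t + (ρ * lam) ^ 2 / 2)) (ρ * lam) (min_le_left _ _) hr_pos).1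
    t h1 h2
  have hI : ∫ x in ball (lam • y₀) (ρ * lam), ‖u t x‖ ^ 2 ≤ (ρ * lam) * C :=
    (inv_mul_le_iff₀ hr_pos).1 hH
  calc lam⁻¹ * ∫ x in ball (lam • y₀) (ρ * lam), ‖u t x‖ ^ 2
      ≤ lam⁻¹ * ((ρ * lam) * C) := by gcongr
    _ = C * ρ := by field_simp

end Summit.NavierStokesRegularity.NavierStokesRegularity.Theorems

end
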